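import Mathlib.RingTheory.Filtration
import HarnessLib

/-!
# Differential operators with a PULLDOWN BOUND along an ideal (Hironaka 2011 §27, Def. 27.1; Th. 27.1 (3)) — MODEL

Topic: `Literature/AlgebraicGeometry/Resolution`. One model definition (+ its set form) and one PROVED model theorem;
no named facts, no `sorry`.

H. Hironaka's 2011 manuscript *Resolution of singularities* (Tordesillas, September 2011; UNREFEREED earlier version
of the programme whose 2017 form is `pRes.pdf` — CONTEXT class, bib `Hironaka2011Tordesillas`), §27 «Bounding
pulldown by operators», p. 51 l. 14–16: «we now introduce the way of bounding the pulldown effect on orders of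
functions along S when we apply primitive and square nilpotent differential operators.» Def. 27.1, Eq. (27.1), p. 51
l. 17–36: for a retraction `r : ξ ∈ S ⊂ Z ↘ A_t`, `I(S) ⊂ O_Z` the ideal of `S`, and the sheaf `P(q, r)` of primitive
differential operators, `P_σ(q, r) := ∩_{ν−σ≥0} Ker (P(q, r) → Hom_{B(q,r)}(I(S)^{(ν)}, O_Z / I(S)^{(ν−σ)}))`, where
`J^{(k)}` is the `k`-th SYMBOLIC power; «The number σ can be any integer and it is called bound of degree pulldown or
pulldown bound for short.» Rem. 27.1, p. 51 l. 40–43: «When the pulldown bound σ ≤ 0, we have P_σ(q, r) maps the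
unity 1 ∈ O_Z to I(S)^{(−σ)}.» Th. 27.1 (3), p. 52 l. 4–5: «For every σ < 0 we have no nonzero idempotent operator
belonging to P_σ(q, r).» (no proof printed: the congress page says «Some proofs are too long and are not included»).

## The model (what is typed here, and what is NOT)
* `HasPulldownBound I D σ` — an ADDITIVE map `D : O →+ O` has pulldown bound `σ ∈ ℤ` along the ideal `I` when
  `D (I^ν) ⊆ I^{ν−σ}` for every `ν` (with `I^{ν−σ} := I^{max(ν−σ, 0)}`). ORDINARY powers stand in for the symbolic
  powers `I(S)^{(ν)}` — they coincide when `I` is maximal (`S` = a closed point, the plane-curve beds); additive maps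
  stand in for the `B(q, r)`-module `P(q, r)` of primitive operators.
  -- TODO(general form): symbolic powers `I(S)^{(ν)}`, the q-base algebra `B(q, r)` and `P(q, r)` of Def. 26.1–26.4.
* `pulldownOperators I σ` — the set `P_σ` of the model.
* `eq_zero_of_idempotent_of_hasPulldownBound_neg` — **Th. 27.1 (3) in the model, PROVED (the proof is ours):** if
  `σ < 0`, `D` has pulldown bound `σ`, `D ∘ D = D`, and `⋂_ν I^ν = 0` (Krull; e.g. `I ≠ ⊤` in a Noetherian local
  ring, Mathlib `Ideal.iInf_pow_eq_bot_of_isLocalRing`), then `D = 0`: `D f = D^k f ∈ I^k` for every `k`.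
  Corollary `eq_zero_of_idempotent_of_hasPulldownBound_neg_of_isLocalRing` supplies Krull.

Use (res-hironaka RESCUE D-0124, catalogue row RR-113 / A-014 «℘nega-alt»): the Rescue row cites this model; nothing
here is a statement of the 2017 manuscript [Hironaka2017] and nothing of either manuscript is asserted as a fact.

## References
* H. Hironaka, *Resolution of singularities*, manuscript, Tordesillas 2011, §27 Def. 27.1 p. 51, Rem. 27.1 p. 51,
  Th. 27.1 (3) p. 52 (unrefereed; context class). [Hironaka2011Tordesillas]
-/

namespace Literature.AlgebraicGeometry.Resolution.PulldownBound

variable {O : Type*} [CommRing O]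

/-- **Pulldown bound (model of Hironaka 2011, Def. 27.1, Eq. (27.1), p. 51 l. 17–36).** An additive map `D : O →+ O`
has pulldown bound `σ ∈ ℤ` along the ideal `I` if `D` maps `I^ν` into `I^{ν−σ}` for every `ν : ℕ` (exponent
truncated at `0`). MODEL: ordinary powers `I^ν` stand in for the symbolic powers `I(S)^{(ν)}` of the printed
definition (equal for `I` maximal), additive maps for the primitive operators `P(q, r)`; «σ … is called bound of
degree pulldown or pulldown bound for short» (p. 51 l. 37–38). REAL definition.
-- TODO(general form): symbolic powers and the `B(q,r)`-module `P(q,r)` (Def. 26.1–26.4).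
[cite: Hironaka2011Tordesillas, Def. 27.1 Eq. (27.1) p.51 l.17–36] -/
def HasPulldownBound (I : Ideal O) (D : O →+ O) (σ : ℤ) : Prop :=
  ∀ (ν : ℕ) (f : O), f ∈ I ^ ν → D f ∈ I ^ ((ν : ℤ) - σ).toNat

/-- **`P_σ` (model of Hironaka 2011, Eq. (27.1), p. 51 l. 18–25):** the set of additive maps with pulldown bound `σ`
along `I`. REAL definition. [cite: Hironaka2011Tordesillas, Def. 27.1 Eq. (27.1) p.51 l.18–25] -/
def pulldownOperators (I : Ideal O) (σ : ℤ) : Set (O →+ O) :=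
  {D | HasPulldownBound I D σ}

/-- Membership in `P_σ` is the pulldown-bound predicate (plumbing). [cite: Hironaka2011Tordesillas, Def. 27.1 p.51 l.18–25] -/
theorem mem_pulldownOperators_iff {I : Ideal O} {σ : ℤ} {D : O →+ O} :
    D ∈ pulldownOperators I σ ↔ HasPulldownBound I D σ := Iff.rfl

/-- **Monotonicity in the bound (model of Th. 27.1 (1), p. 51 l. 56–57: «P_σ(q, r)_ξ ⊂ P_τ(q, r)_ξ for all σ < τ»):**
a pulldown bound `σ` is also a pulldown bound `τ` for every `τ ≥ σ`. PROVED in the model.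
[cite: Hironaka2011Tordesillas, Th. 27.1 (1) p.51 l.56–57] -/
theorem HasPulldownBound.mono {I : Ideal O} {D : O →+ O} {σ τ : ℤ} (hD : HasPulldownBound I D σ) (hστ : σ ≤ τ) :
    HasPulldownBound I D τ := by
  intro ν f hf
  refine Ideal.pow_le_pow_right ?_ (hD ν f hf)
  exact Int.toNat_le_toNat (by omega)

/-- **Rem. 27.1 in the model (p. 51 l. 40–41: «When the pulldown bound σ ≤ 0, we have P_σ(q, r) maps the unity
1 ∈ O_Z to I(S)^{(−σ)}»):** with `σ ≤ 0`, `D 1 ∈ I^{−σ}` — indeed every `D f ∈ I^{−σ}`. PROVED in the model.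
[cite: Hironaka2011Tordesillas, Rem. 27.1 p.51 l.40–41] -/
theorem HasPulldownBound.apply_mem_pow_neg {I : Ideal O} {D : O →+ O} {σ : ℤ} (hD : HasPulldownBound I D σ)
    (f : O) : D f ∈ I ^ (-σ).toNat := by
  simpa using hD 0 f (by simp)

/-- **Iterates gain `−σ` powers each time** (`σ ≤ 0`): with pulldown bound `σ`, `D^[k] f ∈ I^{k·(−σ)}` for
every `k` and `f`. PROVED in the model (induction on `k`).
[cite: Hironaka2011Tordesillas, Th. 27.1 (3) p.52 l.4–5 (model proof step, ours)] -/
theorem HasPulldownBound.iterate_apply_mem_pow {I : Ideal O} {D : O →+ O} {σ : ℤ} (hD : HasPulldownBound I D σ)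
    (hσ : σ ≤ 0) (k : ℕ) (f : O) : D^[k] f ∈ I ^ (k * (-σ).toNat) := by
  have hm : (((-σ).toNat : ℕ) : ℤ) = -σ := Int.toNat_of_nonneg (by omega)
  induction k with
  | zero => simp
  | succ k ih =>
    rw [Function.iterate_succ_apply']
    have h := hD (k * (-σ).toNat) (D^[k] f) ih
    have hexp : (((k * (-σ).toNat : ℕ) : ℤ) - σ) = (((k + 1) * (-σ).toNat : ℕ) : ℤ) := by
      push_cast
      rw [hm]
      ring
    rwa [hexp, Int.toNat_natCast] at h

/-- **Th. 27.1 (3) in the model — no non-zero idempotent with negative pulldown bound (PROVED; the proof is ours,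
none is printed):** if `σ < 0`, `D ∈ P_σ`, `D ∘ D = D` and `⋂_ν I^ν = 0`, then `D = 0`. Printed: «For every σ < 0 we
have no nonzero idempotent operator belonging to P_σ(q, r).» (p. 52 l. 4–5). Proof: `D f = D^[k] f ∈ I^k` for all
`k ≥ 1` (iterates, `−σ ≥ 1`), hence `D f ∈ ⋂_ν I^ν = 0`.
[cite: Hironaka2011Tordesillas, Th. 27.1 (3) p.52 l.4–5] -/
theorem eq_zero_of_idempotent_of_hasPulldownBound_neg {I : Ideal O} {σ : ℤ} (hσ : σ < 0) {D : O →+ O}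
    (hD : HasPulldownBound I D σ) (hidem : ∀ f, D (D f) = D f) (hsep : ⨅ ν : ℕ, I ^ ν = ⊥) : D = 0 := by
  ext f
  rw [AddMonoidHom.zero_apply, ← Ideal.mem_bot, ← hsep, Ideal.mem_iInf]
  intro ν
  -- `D f = D^[ν+1] f`
  have hiter : ∀ k : ℕ, D^[k + 1] f = D f := by
    intro k
    induction k with
    | zero => simp
    | succ k ih => rw [Function.iterate_succ_apply', ih, hidem]
  have hmem := hD.iterate_apply_mem_pow hσ.le (ν + 1) f
  rw [hiter] at hmem
  refine Ideal.pow_le_pow_right ?_ hmem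
  have h1 : 1 ≤ (-σ).toNat := by
    have : (((-σ).toNat : ℕ) : ℤ) = -σ := Int.toNat_of_nonneg (by omega)
    omega
  calc ν ≤ (ν + 1) * 1 := by omega
    _ ≤ (ν + 1) * (-σ).toNat := Nat.mul_le_mul_left _ h1

/-- **The same at a proper ideal of a Noetherian local ring** (Krull's intersection theorem supplies `⋂_ν I^ν = 0`,
Mathlib `Ideal.iInf_pow_eq_bot_of_isLocalRing`) — the placement of the plane-curve beds (`I = 𝔪_ξ`, `S` a closed
point, where ordinary and symbolic powers agree). [cite: Hironaka2011Tordesillas, Th. 27.1 (3) p.52 l.4–5] -/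
theorem eq_zero_of_idempotent_of_hasPulldownBound_neg_of_isLocalRing [IsNoetherianRing O] [IsLocalRing O]
    {I : Ideal O} (hI : I ≠ ⊤) {σ : ℤ} (hσ : σ < 0) {D : O →+ O} (hD : HasPulldownBound I D σ)
    (hidem : ∀ f, D (D f) = D f) : D = 0 :=
  eq_zero_of_idempotent_of_hasPulldownBound_neg hσ hD hidem (Ideal.iInf_pow_eq_bot_of_isLocalRing I hI)

end Literature.AlgebraicGeometry.Resolution.PulldownBound
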